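import Literature.NumberTheory.EllipticCurves.FineSelmerClassGroupPRankBoundedProofs
import Literature.NumberTheory.IwasawaTheory.ClassicalMuInvariantOnePrimeProofs
import Literature.NumberTheory.IwasawaTheory.Fukuda1994Thm1Proofs
import Literature.NumberTheory.IwasawaTheory.Fukuda1994Thm1RankProofs
import HarnessLib

/-!
# The class-group doors to Coates–Sujatha's statement (A), UNCONDITIONAL: Iwasawa 1956 / Fukuda 1994 Thm. 1 (1), (2)
# ∘ Coates–Sujatha Thm. 3.4 (bounded-`p`-rank form) — no named fact (proved; no definition)

`Proofs`-style file in topic `NumberTheory/EllipticCurves`, namespace `Literature.NumberTheory.EllipticCurves.CoatesSujatha2005`,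
written by the prover seat `bsd-potss-k8t-c4` g21 (cell `bsd-potss`, K8-t′ route, item stmt-BirchSwinnertonDyer-19982; closes nothing).
The three doors of `FineSelmerMuRoadDoors` (conjA-anchor g8) reach statement (A) for `E` at `p` from class-group numerics of `L = K(E[p])`
through TWO named facts each (`hIw`/`hF1`/`hF2` and `hCS`). Since then Iwasawa 1956 (`iwasawa1956_…_holds`), Fukuda Thm. 1 (1)
(`fukuda1994_thm1_classNumberPExp_const_of_succ_eq_holds`, k8t-c4 g19) and Thm. 1 (2) (`fukuda1994_thm1_classGroupPRank_const_of_succ_eq_holds`,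
k8t-c4 g20) became tree theorems, and the sibling `FineSelmerClassGroupPRankBoundedProofs` proves Coates–Sujatha's Thm. 3.4 in the form these
criteria actually deliver — BOUNDED `p`-ranks of `Cl(L_m)` along the cyclotomic tower ⟹ (A). Composing, the three doors hold with NO named-fact
hypothesis at all (and over any number field `K`, with no hypothesis on `L ∩ K_∞`):

* `fineSelmerDual_moduleFinite_of_not_dvd_classNumber_of_unique_prime'` — **Door 1**: `p ∤ h(L)` and ONE prime of `L` above `p` ⟹ (A)
  (Iwasawa 1956: `e_m = 0` for all `m`, so `rank_p Cl(L_m) = 0`).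
* `fineSelmerDual_moduleFinite_of_classNumberPExp_succ_eq'` — **Door 2**: Fukuda index `n₀ = 0` and `ord_p h(L_{n+1}) = ord_p h(L_n)` ⟹ (A)
  (`e_m` constant for `m ≥ n`, and `rank_p ≤ e`).
* `fineSelmerDual_moduleFinite_of_classGroupPRank_succ_eq'` — **Door 3**: `n₀ = 0` and `rank_p Cl(L_{n+1}) = rank_p Cl(L_n)` ⟹ (A).

HONEST FRAMING: statement (A) (Coates–Sujatha's Conjecture A) is NOT proved for any class of curves here; each door turns it, for ONE curve and
ONE odd prime, into finitely many class-group integers of `K(E[p])`, which remain displayed hypotheses of every record that uses a door.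

References: [CoatesSujatha2005] Thm. 3.4; [Greenberg2001IwasawaPastPresent] Prop. 2.1; [Fukuda1994] Thm. 1; [Washington1997] §13.3;
[KuriharaPollack2007] §3.1.
-/

set_option autoImplicit false

noncomputable section

open scoped Classical NumberField
open NumberField IsDedekindDomain Field IntermediateField

namespace Literature.NumberTheory.EllipticCurves.CoatesSujatha2005

open WeierstrassCurve Literature.NumberTheory.IwasawaTheory Literature.NumberTheory.GaloisRepresentations
  Literature.NumberTheory.EllipticCurves Literature.NumberTheory.EllipticCurves.ZpExtension

/-! ## §0 `rank_p Cl ≤ ord_p h` at every layer -/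

/-- `rank_p Cl(K_m) ≤ ord_p #Cl(K_m)` for the layers of a `ℤ_p`-extension of a number field: `[Cl : Cl^p] = p^{rank}` divides
`#Cl`. [cite: Fukuda1994, p. 264 (definition of `rank(M)`)] -/
theorem classGroupPRank_le_classNumberPExp {F : Type} [Field F] [NumberField F] {p : ℕ} [Fact p.Prime]
    (κF : ZpExtension F p) (m : ℕ) : classGroupPRank κF m ≤ classNumberPExp κF m := by
  haveI : FiniteDimensional F (κF.layer m) := κF.finiteDimensional_layer_holds m
  haveI : NumberField (κF.layer m) := NumberField.of_module_finite F (κF.layer m)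
  have hidx := index_range_pow_layer_eq κF m
  have hdvd : (powMonoidHom p : ClassGroup (𝓞 ↥(κF.layer m)) →* ClassGroup (𝓞 ↥(κF.layer m))).range.index ∣
      Nat.card (ClassGroup (𝓞 ↥(κF.layer m))) := Subgroup.index_dvd_card _
  rw [hidx] at hdvd
  rw [classNumberPExp_def]
  exact (padicValNat_dvd_iff_le (Nat.card_pos (α := ClassGroup (𝓞 ↥(κF.layer m)))).ne').1 hdvd

variable {K : Type} [Field K] [NumberField K] (W : WeierstrassCurve K) [W.IsElliptic] (p : ℕ) [Fact p.Prime]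

/-! ## §1 Door 1 — Iwasawa 1956 -/

/-- **Door 1, unconditional (Iwasawa 1956 ∘ Coates–Sujatha Thm. 3.4).** For `E = W` elliptic over a number field `K`, `p` odd and
`L = K(E[p])`: if `p ∤ h(L)` and exactly ONE prime of `L` lies above `p`, then statement (A) holds for `E` at `p` over the
cyclotomic `ℤ_p`-extension (the dual fine Selmer group is finitely generated over `ℤ_p`). Both hypotheses are numeric; NO named fact
(`FineSelmerMuRoadDoors.fineSelmerDual_moduleFinite_of_not_dvd_classNumber_of_unique_prime` with `hIw`, `hCS` discharged).
[cite: Greenberg2001IwasawaPastPresent, Prop. 2.1 p. 339] [cite: CoatesSujatha2005, Thm. 3.4 (§3)] -/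
theorem fineSelmerDual_moduleFinite_of_not_dvd_classNumber_of_unique_prime' (hp : p ≠ 2)
    (hh : haveI : NeZero p := ⟨(Fact.out : p.Prime).ne_zero⟩
      haveI : NumberField (W.divisionField p) := NumberField.of_module_finite K _
      ¬ p ∣ NumberField.classNumber (W.divisionField p))
    (hv : haveI : NeZero p := ⟨(Fact.out : p.Prime).ne_zero⟩
      haveI : NumberField (W.divisionField p) := NumberField.of_module_finite K _
      ∃! v : HeightOneSpectrum (𝓞 (W.divisionField p)), ((p : ℕ) : 𝓞 (W.divisionField p)) ∈ v.asIdeal)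
    (κ : ZpExtension K p) (hκ : κ.IsCyclotomic) :
    ∃ (γ : absoluteGaloisGroup K) (D : W.FineSelmerDualData κ γ),
      Module.Finite ℤ_[p] (RestrictScalars ℤ_[p] (IwasawaAlgebra p) D.X) := by
  haveI : NeZero p := ⟨(Fact.out : p.Prime).ne_zero⟩
  haveI : NumberField (W.divisionField p) := NumberField.of_module_finite K _
  refine fineSelmerDual_moduleFinite_of_forall_classGroupPRank_le W hp 0 (fun κL _ m => ?_) κ hκ
  have h0 := iwasawa1956_classNumberPExp_eq_zero_of_not_dvd_classNumber_of_unique_prime_holds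
    ↥(W.divisionField p) p hh hv κL m
  have := classGroupPRank_le_classNumberPExp κL m
  omega

/-! ## §2 Door 2 — Fukuda 1994 Thm. 1 (1) -/

/-- **Door 2, unconditional (Fukuda Thm. 1 (1) ∘ Coates–Sujatha Thm. 3.4), at any layer `n`.** If every cyclotomic `ℤ_p`-extension
`κ_L` of `L = K(E[p])` has Fukuda's index `n₀ = 0` (`TotallyRamifiedFrom κ_L 0`) and `ord_p h(L_{n+1}) = ord_p h(L_n)` for ONE `n`, then
statement (A) holds for `E` at the odd prime `p`: `e_m = e_n` for `m ≥ n` (Fukuda, tree theorem) and `rank_p Cl(L_m) ≤ e_m`, so the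
`p`-ranks are bounded. NO named fact. [cite: Fukuda1994, Thm. 1 (1), p. 264] [cite: CoatesSujatha2005, Thm. 3.4 (§3)] -/
theorem fineSelmerDual_moduleFinite_of_classNumberPExp_succ_eq' (hp : p ≠ 2) (n : ℕ)
    (hram : haveI : NeZero p := ⟨(Fact.out : p.Prime).ne_zero⟩
      ∀ κL : ZpExtension (W.divisionField p) p, κL.IsCyclotomic → TotallyRamifiedFrom κL 0)
    (hord : haveI : NeZero p := ⟨(Fact.out : p.Prime).ne_zero⟩
      ∀ κL : ZpExtension (W.divisionField p) p, κL.IsCyclotomic →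
        classNumberPExp κL (n + 1) = classNumberPExp κL n)
    (κ : ZpExtension K p) (hκ : κ.IsCyclotomic) :
    ∃ (γ : absoluteGaloisGroup K) (D : W.FineSelmerDualData κ γ),
      Module.Finite ℤ_[p] (RestrictScalars ℤ_[p] (IwasawaAlgebra p) D.X) := by
  haveI : NeZero p := ⟨(Fact.out : p.Prime).ne_zero⟩
  haveI : NumberField (W.divisionField p) := NumberField.of_module_finite K _
  -- one cyclotomic `ℤ_p`-extension `κ₀` of `L` (the shifted base change of `κ`) fixes the bound
  obtain ⟨a, κ₀, hs⟩ := exists_zpExtension_shift κ ↥(W.divisionField p)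
  have hκ₀ : κ₀.IsCyclotomic := isCyclotomic_of_shift κ _ κ₀ hs hκ
  set B : ℕ := (Finset.range (n + 1)).sup (classNumberPExp κ₀) with hB
  refine fineSelmerDual_moduleFinite_of_classGroupPRank_le W hp κ hκ B ⟨κ₀, hκ₀, fun m => ?_⟩
  refine (classGroupPRank_le_classNumberPExp κ₀ m).trans ?_
  by_cases hm : m ≤ n
  · exact Finset.le_sup (f := classNumberPExp κ₀) (Finset.mem_range.2 (Nat.lt_succ_of_le hm))
  · have hconst := fukuda1994_thm1_classNumberPExp_const_of_succ_eq_holds ↥(W.divisionField p) p κ₀ 0 (hram κ₀ hκ₀) n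
      (Nat.zero_le n) (hord κ₀ hκ₀) m (le_of_not_ge hm)
    rw [hconst]
    exact Finset.le_sup (f := classNumberPExp κ₀) (Finset.mem_range.2 (Nat.lt_succ_self n))

/-! ## §3 Door 3 — Fukuda 1994 Thm. 1 (2) -/

/-- **Door 3, unconditional (Fukuda Thm. 1 (2) ∘ Coates–Sujatha Thm. 3.4), at any layer `n`.** As Door 2 with the `p`-RANK
certificate `rank_p Cl(L_{n+1}) = rank_p Cl(L_n)`: the ranks are then constant from `n` on (Fukuda, tree theorem), hence bounded.
NO named fact. [cite: Fukuda1994, Thm. 1 (2), p. 264] [cite: CoatesSujatha2005, Thm. 3.4 (§3)] -/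
theorem fineSelmerDual_moduleFinite_of_classGroupPRank_succ_eq' (hp : p ≠ 2) (n : ℕ)
    (hram : haveI : NeZero p := ⟨(Fact.out : p.Prime).ne_zero⟩
      ∀ κL : ZpExtension (W.divisionField p) p, κL.IsCyclotomic → TotallyRamifiedFrom κL 0)
    (hrk : haveI : NeZero p := ⟨(Fact.out : p.Prime).ne_zero⟩
      ∀ κL : ZpExtension (W.divisionField p) p, κL.IsCyclotomic →
        classGroupPRank κL (n + 1) = classGroupPRank κL n)
    (κ : ZpExtension K p) (hκ : κ.IsCyclotomic) :
    ∃ (γ : absoluteGaloisGroup K) (D : W.FineSelmerDualData κ γ),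
      Module.Finite ℤ_[p] (RestrictScalars ℤ_[p] (IwasawaAlgebra p) D.X) := by
  haveI : NeZero p := ⟨(Fact.out : p.Prime).ne_zero⟩
  haveI : NumberField (W.divisionField p) := NumberField.of_module_finite K _
  obtain ⟨a, κ₀, hs⟩ := exists_zpExtension_shift κ ↥(W.divisionField p)
  have hκ₀ : κ₀.IsCyclotomic := isCyclotomic_of_shift κ _ κ₀ hs hκ
  set B : ℕ := (Finset.range (n + 1)).sup (classGroupPRank κ₀) with hB
  refine fineSelmerDual_moduleFinite_of_classGroupPRank_le W hp κ hκ B ⟨κ₀, hκ₀, fun m => ?_⟩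
  by_cases hm : m ≤ n
  · exact Finset.le_sup (f := classGroupPRank κ₀) (Finset.mem_range.2 (Nat.lt_succ_of_le hm))
  · have hconst := (fukuda1994_thm1_classGroupPRank_const_of_succ_eq_holds ↥(W.divisionField p) p κ₀ 0 (hram κ₀ hκ₀) n
      (Nat.zero_le n) (hrk κ₀ hκ₀)).1 m (le_of_not_ge hm)
    rw [hconst]
    exact Finset.le_sup (f := classGroupPRank κ₀) (Finset.mem_range.2 (Nat.lt_succ_self n))

end Literature.NumberTheory.EllipticCurves.CoatesSujatha2005

end
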